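import Summits.NavierStokesRegularity.NavierStokesRegularity.Theorems.RungBlowupCofinal.SolidHarmonicLifts
import HarnessLib

/-!
# Azimuthal transport of solid-harmonic lifts on the angular Galerkin ladder: zonal scalars lift
# to zonal fields, wave pairs lift to azimuthal waves
# (route `AngularGalerkinLadder`, crux K1 `RungBlowupCofinal`; kinematic helper, theorems only)

Cell `ns-blowup`, seat `ns-blowup-circuit` (g11, AGL Lean seat). Helper file for
`stmt-NavierStokesRegularity-19959` (line `Cruxes/RungBlowupCofinal/Lines/qlwave.lean`), continuing
`SolidHarmonicLifts.lean`. LABEL: KERNEL kinematics. Nothing here asserts a Theses declaration; no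
definition, no named fact. WHAT THIS IS NOT: not Navier–Stokes evidence; not a profile — the
`J₃ = angGen 2` bookkeeping of the three lifts `∇φ`, `φ(x)x`, `x × ∇φ(x)` of a smooth scalar `φ`,
i.e. how the letters `Qlwave.IsZonal` (`J₃V = 0`) and `Qlwave.IsAzimuthalWave m` (`J₃²W = −m²W`)
are met by explicit ansätze.

## Content

With `K₂φ = (y ↦ −Dφ(y)(e₂ × y))` (the scalar rotation derivative of the tree's `angGen_gradient`):

* ZONAL scalars (`K₂φ = 0`, e.g. the zonal solid harmonics `r^j P_j(y₂/r)`) lift to ZONAL fields: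
  `angGen_two_gradient_of_zonal`, `angGen_two_smulSelf_of_zonal`, `angGen_two_crossSelf_gradient_of_zonal`.
* WAVE PAIRS (`K₂φ = mψ`, `K₂ψ = −mφ`, e.g. `φ, ψ = Re, Im (y₀ + iy₁)^m·(zonal factor)`) lift to
  `m`-fold azimuthal waves `J₃(J₃U) = −m²U`: `wave_gradient`, `wave_smulSelf`, `wave_crossSelf_gradient`.

[cite: BullardGellman1954] (azimuthal order `m` of vector spherical harmonics; here projection-free).
-/

noncomputable section

namespace Summit.NavierStokesRegularity.AngularGalerkinLadderSolidHarmonicTransport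

open Set Function
open scoped ContDiff RealInnerProductSpace
open Literature.Analysis.FluidPDE
open Summit.NavierStokesRegularity.FluidComputer
open Summit.NavierStokesRegularity.FluidComputer.AngularLadder
open Summit.NavierStokesRegularity.AngularGalerkinLadderToroidalLift
open Summit.NavierStokesRegularity.AngularGalerkinLadderSolidHarmonicLifts

variable {φ ψ : EuclideanSpace ℝ (Fin 3) → ℝ}

/-- `∇(c φ) = c ∇φ`. [folklore] -/
private theorem gradient_const_mul' (hφ : Differentiable ℝ φ) (r : ℝ) :
    gradient (fun y => r * φ y) = fun y => r • gradient φ y := by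
  funext y
  refine ext_inner_right ℝ fun w => ?_
  rw [inner_gradient_left, real_inner_smul_left, inner_gradient_left, fderiv_const_mul (hφ y) r]
  simp only [FunLike.coe_smul, Pi.smul_apply, smul_eq_mul]

/-- The gradient field of a smooth function is smooth. [folklore] -/
private theorem contDiff_gradient' (hφ : ContDiff ℝ ∞ φ) : ContDiff ℝ ∞ (gradient φ) := by
  set Lr : (EuclideanSpace ℝ (Fin 3) →L[ℝ] ℝ) →L[ℝ] EuclideanSpace ℝ (Fin 3) :=
    (InnerProductSpace.toDual ℝ (EuclideanSpace ℝ (Fin 3))).symm.toContinuousLinearEquiv.toContinuousLinearMap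
    with hLr
  have h1 : gradient φ = fun y => Lr (fderiv ℝ φ y) := rfl
  rw [h1]
  exact Lr.contDiff.comp (contDiff_infty_iff_fderiv.1 hφ).2

/-! ## Zonal scalars lift to zonal fields; wave pairs lift to azimuthal waves -/

/-- Radial lift of a ZONAL scalar (`K₂φ = 0`) is a zonal field (`J₃ = 0`). [folklore] -/
theorem angGen_two_smulSelf_of_zonal (hφ : Differentiable ℝ φ)
    (hz : ∀ y, -fderiv ℝ φ y (crossCLM (axis 2) y) = 0) (y : EuclideanSpace ℝ (Fin 3)) :
    angGen 2 (fun x : EuclideanSpace ℝ (Fin 3) => φ x • x) y = 0 := by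
  rw [angGen_smulSelf hφ 2]
  simp only [hz y, zero_smul]

/-- Gradient lift of a ZONAL scalar is zonal. [folklore] -/
theorem angGen_two_gradient_of_zonal (hφ : ContDiff ℝ ∞ φ)
    (hz : ∀ y, -fderiv ℝ φ y (crossCLM (axis 2) y) = 0) (y : EuclideanSpace ℝ (Fin 3)) :
    angGen 2 (gradient φ) y = 0 := by
  rw [angGen_gradient hφ 2, show (fun z => -fderiv ℝ φ z (crossCLM (axis 2) z)) = fun _ => (0 : ℝ)
    from funext hz]
  refine ext_inner_right ℝ fun w => ?_
  rw [inner_gradient_left, inner_zero_left]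
  simp

/-- Toroidal lift of a ZONAL scalar is zonal. [folklore] -/
theorem angGen_two_crossSelf_gradient_of_zonal (hφ : ContDiff ℝ ∞ φ)
    (hz : ∀ y, -fderiv ℝ φ y (crossCLM (axis 2) y) = 0) (y : EuclideanSpace ℝ (Fin 3)) :
    angGen 2 (fun x => cross x (gradient φ x)) y = 0 :=
  zonal_crossSelf ((contDiff_gradient' hφ).differentiable (by simp))
    (angGen_two_gradient_of_zonal hφ hz) y

/-- Radial lift of a WAVE PAIR: if `K₂φ = m ψ` and `K₂ψ = −m φ` then `J₃(J₃(φ x)) = −m² (φ x)`.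
[folklore] -/
theorem wave_smulSelf {ψ : EuclideanSpace ℝ (Fin 3) → ℝ} (hφ : ContDiff ℝ ∞ φ) (hψ : ContDiff ℝ ∞ ψ)
    {m : ℝ} (h1 : ∀ y, -fderiv ℝ φ y (crossCLM (axis 2) y) = m * ψ y)
    (h2 : ∀ y, -fderiv ℝ ψ y (crossCLM (axis 2) y) = -m * φ y) (y : EuclideanSpace ℝ (Fin 3)) :
    angGen 2 (angGen 2 fun x : EuclideanSpace ℝ (Fin 3) => φ x • x) y =
      -((m ^ 2) • (φ y • y)) := by
  have hφd : Differentiable ℝ φ := hφ.differentiable (by simp)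
  have hψd : Differentiable ℝ ψ := hψ.differentiable (by simp)
  have e1 : angGen 2 (fun x : EuclideanSpace ℝ (Fin 3) => φ x • x) =
      fun x : EuclideanSpace ℝ (Fin 3) => (m * ψ x) • x := by
    rw [angGen_smulSelf hφd 2]
    funext x
    rw [h1 x]
  have hmψ : Differentiable ℝ fun x => m * ψ x := hψd.const_mul m
  rw [e1, angGen_smulSelf hmψ 2]
  simp only [fderiv_const_mul (hψd y), FunLike.coe_smul, Pi.smul_apply, smul_eq_mul]
  rw [show -(m * fderiv ℝ ψ y (crossCLM (axis 2) y)) = m * (-fderiv ℝ ψ y (crossCLM (axis 2) y))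
    by ring, h2 y, smul_smul, sq]
  simp only [neg_mul, mul_neg, neg_smul, mul_assoc]

/-- Gradient lift of a WAVE PAIR: `J₃(J₃ ∇φ) = −m² ∇φ`. [folklore] -/
theorem wave_gradient {ψ : EuclideanSpace ℝ (Fin 3) → ℝ} (hφ : ContDiff ℝ ∞ φ) (hψ : ContDiff ℝ ∞ ψ)
    {m : ℝ} (h1 : ∀ y, -fderiv ℝ φ y (crossCLM (axis 2) y) = m * ψ y)
    (h2 : ∀ y, -fderiv ℝ ψ y (crossCLM (axis 2) y) = -m * φ y) (y : EuclideanSpace ℝ (Fin 3)) :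
    angGen 2 (angGen 2 (gradient φ)) y = -((m ^ 2) • gradient φ y) := by
  have hφd : Differentiable ℝ φ := hφ.differentiable (by simp)
  have hψd : Differentiable ℝ ψ := hψ.differentiable (by simp)
  have hGψ : Differentiable ℝ (gradient ψ) := (contDiff_gradient' hψ).differentiable (by simp)
  have e1 : angGen 2 (gradient φ) = (m : ℝ) • gradient ψ := by
    rw [angGen_gradient hφ 2, show (fun z => -fderiv ℝ φ z (crossCLM (axis 2) z)) =
      fun z => m * ψ z from funext h1, gradient_const_mul' hψd]
    rfl
  have e2 : angGen 2 (gradient ψ) = (-m : ℝ) • gradient φ := by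
    rw [angGen_gradient hψ 2, show (fun z => -fderiv ℝ ψ z (crossCLM (axis 2) z)) =
      fun z => (-m) * φ z from funext h2, gradient_const_mul' hφd]
    rfl
  rw [e1, angGen_smul hGψ, Pi.smul_apply, e2, Pi.smul_apply, smul_smul, sq]
  simp only [mul_neg, neg_smul]

/-- Toroidal lift of a WAVE PAIR: `J₃(J₃ (x × ∇φ)) = −m² (x × ∇φ)`. [folklore] -/
theorem wave_crossSelf_gradient {ψ : EuclideanSpace ℝ (Fin 3) → ℝ} (hφ : ContDiff ℝ ∞ φ)
    (hψ : ContDiff ℝ ∞ ψ) {m : ℝ} (h1 : ∀ y, -fderiv ℝ φ y (crossCLM (axis 2) y) = m * ψ y)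
    (h2 : ∀ y, -fderiv ℝ ψ y (crossCLM (axis 2) y) = -m * φ y) (y : EuclideanSpace ℝ (Fin 3)) :
    angGen 2 (angGen 2 fun x => cross x (gradient φ x)) y = -((m ^ 2) • cross y (gradient φ y)) :=
  wave_crossSelf (contDiff_gradient' hφ) (wave_gradient hφ hψ h1 h2) y


end Summit.NavierStokesRegularity.AngularGalerkinLadderSolidHarmonicTransport

end
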